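import Literature.Analysis.FluidPDE.LocalLerayPressureDecompositionHolds
import Literature.Analysis.FluidPDE.LocalLerayPressureDecompositionProofs
import Literature.Analysis.FluidPDE.LocalLeraySlabCubicIntegrability
import HarnessLib

/-!
# The local pressure expansion on a slab, slice by slice, and the far field of the difference
of two velocity fields

Analysis/FluidPDE proof file (theorems only, everything PROVED, no definitions, no named facts)
on the inline proof path of the named fact
`Literature.Analysis.FluidPDE.local_leray_weak_strong_uniqueness` (**U**; P. G. Lemarié-Rieusset,
*The Navier–Stokes Problem in the 21st Century* (2016), **Thm. 14.7**, weak–strong uniqueness for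
local Leray solutions, held copy file pp. 514–518), part "pressure estimates" of the printed
proof (pp. 516–517: the local pressure `q_{x₀} = R₁ + R₂ + S₁ + S₂` of the difference
`w = u₁ - u₂`, with the far-field terms `S₁, S₂ = ∫_{|y-x₀|>5R₀} (𝕂(x-y) - 𝕂(x₀-y)) ℍ dy`,
`ℍ = w ⊗ u₁ + u₁ ⊗ w - w ⊗ w = u₁ ⊗ u₁ - u₂ ⊗ u₂`).

The tree has the local pressure expansion of ONE local Leray solution (Kang–Miura–Tsai 2021,
Lemma 3.4: `π = π_loc + π_far + c_{x₀,r}(t)` on `B_r(x₀) × (0,T)`, proved as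
`kangMiuraTsai_pressure_decomposition_holds` for the global class, through the slab-level slice
identities `IsLocalLeraySolutionOn.ae_slice_pgIdentity` and `slice_pressure_representation`).
This file records what the weak–strong argument needs about it for TWO solutions on a slab
`(0,T) × ℝ³` with viscosity `ν`:

* §1 `IsLocalLeraySolutionOn.ae_exists_slice_representation` — the expansion on a.e. time
  slice for the **slab** class `IsLocalLeraySolutionOn T ν v₀ v π` (Kang–Miura–Tsai Def. 3.2 on
  `(0,T)`; any `ν > 0`, any datum): for a.e. `t ∈ (0,T)` there is `κ(t)` with
  `π(t) = π_loc(t) + π_far(t) + κ(t)` a.e. on `B_r(x₀)` (the proof of the global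
  `IsLocalLeraySolution.ae_exists_slice_representation`, verbatim, with the slab cube
  integrability `IsLocalLeraySolutionOn.lintegral_cube_box_lt_top`);
* §2 `abs_pressureForm_sub_pressureForm_le` — the two-centre (Hörmander) bound for the
  **bilinear** kernel, `|B_{x-y}(a,c) - B_{x₀-y}(a,c)| ≤ C|x-x₀||a||c|/|y-x₀|⁴` for
  `2|x-x₀| ≤ |y-x₀|`, from the tree's quadratic bound `exists_abs_pressureKernel_sub_le` by
  polarisation, the parallelogram law and the scaling `B(a,c) = B(λa, λ⁻¹c)`;
* §3 `integrableOn_farField_of_uloc`, `enorm_localPressureFar_sub_le` — for uniformly locally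
  `L²` slices the far-field integrands converge absolutely on `{|y-x₀| ≥ 2r}` (`r ≥ 1`,
  `x ∈ B_r(x₀)`), and **the difference of the far fields of two fields `U₁, U₂` is the far field
  of `B(U₁ - U₂, U₁ + U₂)`**:
  `‖π_far[U₁](x) - π_far[U₂](x)‖ ≤ C r ∫_{|y-x₀|≥2r} |U₁-U₂||U₁+U₂| |y-x₀|⁻⁴ dy`;
* §4 the unit-ball Hölder inequalities feeding the uniformly local tails of that integral
  (`∫_{B(z,1)}|W| ≤ |B₁|^{1/2}‖W‖_{L²(B(z,1))}`,
  `∫_{B(z,1)}|W||U| ≤ |B₁|^{1/6}‖W‖_{L²(B(z,1))}‖U‖_{L³}`).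

## References

* P. G. Lemarié-Rieusset, *The Navier–Stokes Problem in the 21st Century* (2016),
  doi:10.1201/b19556, Thm. 14.7, proof, file pp. 516–517 (the terms `S₁`, `S₂`).
  [`LemarieRieusset2016`]
* K. Kang, H. Miura, T.-P. Tsai, IMRN 2021 = arXiv:1812.10509, Lemma 3.4 and §8.
  [`KangMiuraTsai2020`]
-/

noncomputable section

open MeasureTheory Set Filter Topology Function Metric
open scoped ENNReal NNReal RealInnerProductSpace

namespace Literature.Analysis.FluidPDE

-- nested operator types in the imported pressure files
set_option maxSynthPendingDepth 3

/-! ## §1. The local pressure expansion on a.e. slice of a slab solution -/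

section SlabSlices

variable {T ν : ℝ} {v₀ : EuclideanSpace ℝ (Fin 3) → EuclideanSpace ℝ (Fin 3)}
  {v : ℝ → EuclideanSpace ℝ (Fin 3) → EuclideanSpace ℝ (Fin 3)}
  {π : ℝ → EuclideanSpace ℝ (Fin 3) → ℝ}

/-- A local Leray solution on the slab `(0,T) × ℝ³` is a.e.-strongly measurable for the product
of the restricted measures on a box `(0,T) × s`. [folklore] -/
theorem IsLocalLeraySolutionOn.aestronglyMeasurable_prod_restrict
    (hv : IsLocalLeraySolutionOn T ν v₀ v π) (s : Set (EuclideanSpace ℝ (Fin 3))) :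
    AEStronglyMeasurable (uncurry v)
      ((volume.restrict (Ioo (0 : ℝ) T)).prod (volume.restrict s)) := by
  rw [Measure.prod_restrict, ← Measure.volume_eq_prod]
  exact hv.aestronglyMeasurable.mono_measure
    (Measure.restrict_mono (Set.prod_mono Subset.rfl (subset_univ _)) le_rfl)

/-- For a.e. `t ∈ (0,T)`, the slice `v(t)` of a local Leray solution on the slab is in `L³` of
every ball (Tonelli on `(0,T) × B_ρ(x₀)`, where `∫∫|v|³ < ∞` by
`IsLocalLeraySolutionOn.lintegral_cube_box_lt_top`). [folklore] -/
theorem IsLocalLeraySolutionOn.ae_lintegral_cube_ball_lt_top (hv : IsLocalLeraySolutionOn T ν v₀ v π)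
    (x₀ : EuclideanSpace ℝ (Fin 3)) (ρ : ℝ) :
    ∀ᵐ t ∂(volume.restrict (Ioo (0 : ℝ) T)), ∫⁻ y in ball x₀ ρ, ‖v t y‖ₑ ^ (3 : ℕ) < ⊤ := by
  set μt : Measure ℝ := volume.restrict (Ioo (0 : ℝ) T) with hμt
  set μK : Measure (EuclideanSpace ℝ (Fin 3)) := volume.restrict (ball x₀ ρ) with hμK
  have hprod : μt.prod μK = volume.restrict (Ioo (0 : ℝ) T ×ˢ ball x₀ ρ) := by
    rw [hμt, hμK, Measure.prod_restrict, ← Measure.volume_eq_prod]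
  have hvmK : AEStronglyMeasurable (uncurry v) (μt.prod μK) := hv.aestronglyMeasurable_prod_restrict _
  have hG : AEMeasurable (fun z : ℝ × EuclideanSpace ℝ (Fin 3) => ‖v z.1 z.2‖ₑ ^ (3 : ℕ)) (μt.prod μK) :=
    hvmK.enorm.pow_const _
  have hfin : ∫⁻ t, ∫⁻ x, ‖v t x‖ₑ ^ (3 : ℕ) ∂μK ∂μt < ⊤ := by
    rw [← lintegral_prod _ hG, hprod]
    exact hv.lintegral_cube_box_lt_top x₀ ρ
  exact ae_lt_top' hG.lintegral_prod_right' hfin.ne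

/-- **The local pressure expansion on almost every time slice of a slab solution**
(Kang–Miura–Tsai 2021, Lemma 3.4, slice by slice, for the class of Def. 3.2 on `(0,T)` with any
viscosity): for a local Leray solution `(v, π)` on `(0,T) × ℝ³`, a centre `x₀` and a radius
`r > 0`, for a.e. `t ∈ (0,T)` there is a constant `κ(t)` with
`π(t) = π_loc(t) + π_far(t) + κ(t)` a.e. on `B_r(x₀)` (the Liouville identities on a.e. slice,
`IsLocalLeraySolutionOn.ae_slice_pgIdentity`, fed into `slice_pressure_representation`).
[cite: KangMiuraTsai2020, Lemma 3.4 (pressure decomposition), arXiv:1812.10509 p. 8] -/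
theorem IsLocalLeraySolutionOn.ae_exists_slice_representation (hv : IsLocalLeraySolutionOn T ν v₀ v π)
    (x₀ : EuclideanSpace ℝ (Fin 3)) {r : ℝ} (hr : 0 < r) :
    ∀ᵐ t ∂(volume.restrict (Ioo (0 : ℝ) T)), ∃ κ : ℝ,
      ∀ᵐ x ∂(volume.restrict (ball x₀ r)),
        π t x = localPressureNear x₀ r v t x + localPressureFar x₀ r v t x + κ := by
  obtain ⟨A, hA⟩ := hv.ae_slice_pgIdentity
  filter_upwards [hA, hv.ae_lintegral_cube_ball_lt_top x₀ (2 * r)] with t ht hct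
  obtain ⟨hmt, -, hπt, hAt, -, hid⟩ := ht
  obtain ⟨κ, -, hrep⟩ := slice_pressure_representation (A := (A : ℝ≥0∞)) hmt ENNReal.coe_ne_top
    hAt hπt hid x₀ hr hct.ne
  exact ⟨κ, hrep⟩

/-- For a.e. `t ∈ (0,T)` the far field `x ↦ π_far(t, x)` of a slab solution is a.e.-strongly
measurable (a slice of the jointly measurable far field
`IsLocalLeraySolutionOn.aestronglyMeasurable_localPressureFar`). [folklore] -/
theorem IsLocalLeraySolutionOn.ae_aestronglyMeasurable_localPressureFar_slice
    (hv : IsLocalLeraySolutionOn T ν v₀ v π) (x₀ : EuclideanSpace ℝ (Fin 3)) (r : ℝ) :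
    ∀ᵐ t ∂(volume.restrict (Ioo (0 : ℝ) T)),
      AEStronglyMeasurable (localPressureFar x₀ r v t) volume :=
  (hv.aestronglyMeasurable_localPressureFar x₀ r).prodMk_left

end SlabSlices

/-! ## §2. The two-centre bound for the bilinear kernel -/

section TwoCentre

/-- `K(z)(a) - K(z)(b) = B_z(a - b, a + b)` (private copy of the identity of
`NormalisedPressureBilinear.lean`, to keep the two files independent). [folklore] -/
private theorem pressureKernel_sub_eq_pressureForm' (z a b : EuclideanSpace ℝ (Fin 3)) :
    pressureKernel z a - pressureKernel z b = pressureForm z (a - b) (a + b) := by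
  simp only [pressureKernel_eq_pressureForm, pressureForm, inner_add_right, inner_sub_right,
    inner_sub_left, real_inner_comm a b]
  ring

/-- **Polarisation of the kernel:** `B_z(u, v) = ¼(K(z)(u+v) - K(z)(u-v))`. [folklore] -/
theorem pressureForm_eq_quarter (z u v : EuclideanSpace ℝ (Fin 3)) :
    pressureForm z u v = 4⁻¹ * (pressureKernel z (u + v) - pressureKernel z (u - v)) := by
  simp only [pressureKernel_eq_pressureForm, pressureForm, inner_add_right, inner_sub_right,
    inner_add_left, inner_sub_left, real_inner_comm u v]
  ring

/-- **The two-centre (Hörmander) bound for the bilinear pressure kernel.** If the quadratic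
kernel satisfies `|K(x-y)(a) - K(x₀-y)(a)| ≤ C|x-x₀||a|²/|y-x₀|⁴` whenever `2|x-x₀| ≤ |y-x₀|`,
`y ≠ x₀` (the tree's `exists_abs_pressureKernel_sub_le`), then the bilinear form satisfies
`|B_{x-y}(a,c) - B_{x₀-y}(a,c)| ≤ C|x-x₀||a||c|/|y-x₀|⁴` under the same condition
(polarisation, the parallelogram law, and the scaling `B(a,c) = B(λa, λ⁻¹c)` with
`λ² = |c|/|a|`). [folklore] -/
theorem abs_pressureForm_sub_pressureForm_le {C : ℝ} (hC0 : 0 ≤ C)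
    (hC : ∀ x₀ x y a : EuclideanSpace ℝ (Fin 3), 2 * ‖x - x₀‖ ≤ ‖y - x₀‖ → y ≠ x₀ →
      |pressureKernel (x - y) a - pressureKernel (x₀ - y) a| ≤
        C * ‖x - x₀‖ * ‖a‖ ^ 2 / ‖y - x₀‖ ^ 4)
    {x₀ x y : EuclideanSpace ℝ (Fin 3)} (h2 : 2 * ‖x - x₀‖ ≤ ‖y - x₀‖) (hy : y ≠ x₀)
    (a c : EuclideanSpace ℝ (Fin 3)) :
    |pressureForm (x - y) a c - pressureForm (x₀ - y) a c| ≤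
      C * ‖x - x₀‖ * (‖a‖ * ‖c‖) / ‖y - x₀‖ ^ 4 := by
  have hyx : 0 < ‖y - x₀‖ := norm_pos_iff.2 (sub_ne_zero.2 hy)
  set M : ℝ := C * ‖x - x₀‖ / ‖y - x₀‖ ^ 4 with hM
  have hM0 : 0 ≤ M := by positivity
  have hK : ∀ v : EuclideanSpace ℝ (Fin 3),
      |pressureKernel (x - y) v - pressureKernel (x₀ - y) v| ≤ M * ‖v‖ ^ 2 := fun v =>
    calc |pressureKernel (x - y) v - pressureKernel (x₀ - y) v|
        ≤ C * ‖x - x₀‖ * ‖v‖ ^ 2 / ‖y - x₀‖ ^ 4 := hC x₀ x y v h2 hy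
      _ = M * ‖v‖ ^ 2 := by rw [hM]; ring
  -- quadratic bound for every pair
  have hquad : ∀ u v : EuclideanSpace ℝ (Fin 3),
      |pressureForm (x - y) u v - pressureForm (x₀ - y) u v| ≤ 2⁻¹ * M * (‖u‖ ^ 2 + ‖v‖ ^ 2) := by
    intro u v
    rw [pressureForm_eq_quarter (x - y), pressureForm_eq_quarter (x₀ - y)]
    have e : 4⁻¹ * (pressureKernel (x - y) (u + v) - pressureKernel (x - y) (u - v)) -
        4⁻¹ * (pressureKernel (x₀ - y) (u + v) - pressureKernel (x₀ - y) (u - v)) =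
        4⁻¹ * ((pressureKernel (x - y) (u + v) - pressureKernel (x₀ - y) (u + v)) -
          (pressureKernel (x - y) (u - v) - pressureKernel (x₀ - y) (u - v))) := by ring
    rw [e, abs_mul, abs_of_pos (by norm_num : (0 : ℝ) < 4⁻¹)]
    have h1 := hK (u + v)
    have h2' := hK (u - v)
    have hpar : ‖u + v‖ ^ 2 + ‖u - v‖ ^ 2 = 2 * (‖u‖ ^ 2 + ‖v‖ ^ 2) := by
      have h := parallelogram_law_with_norm ℝ u v
      simp only [sq]
      linarith
    calc 4⁻¹ * |pressureKernel (x - y) (u + v) - pressureKernel (x₀ - y) (u + v) -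
          (pressureKernel (x - y) (u - v) - pressureKernel (x₀ - y) (u - v))|
        ≤ 4⁻¹ * (M * ‖u + v‖ ^ 2 + M * ‖u - v‖ ^ 2) := by
          gcongr
          exact (abs_sub _ _).trans (add_le_add h1 h2')
      _ = 2⁻¹ * M * (‖u‖ ^ 2 + ‖v‖ ^ 2) := by rw [← mul_add, hpar]; ring
  -- scaling
  rcases eq_or_ne a 0 with rfl | ha
  · rw [pressureForm_zero_left, pressureForm_zero_left, sub_zero, abs_zero]
    positivity
  rcases eq_or_ne c 0 with rfl | hc
  · rw [pressureForm_symm _ a 0, pressureForm_symm _ a 0, pressureForm_zero_left, pressureForm_zero_left,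
      sub_zero, abs_zero]
    positivity
  have ha' : 0 < ‖a‖ := norm_pos_iff.2 ha
  have hc' : 0 < ‖c‖ := norm_pos_iff.2 hc
  set l : ℝ := Real.sqrt (‖c‖ / ‖a‖) with hl
  have hl0 : 0 < l := Real.sqrt_pos.2 (div_pos hc' ha')
  have hl2 : l ^ 2 = ‖c‖ / ‖a‖ := Real.sq_sqrt (div_pos hc' ha').le
  have hscale : ∀ z : EuclideanSpace ℝ (Fin 3), pressureForm z a c = pressureForm z (l • a) (l⁻¹ • c) := fun z => by
    rw [pressureForm_smul_left, pressureForm_symm z a (l⁻¹ • c), pressureForm_smul_left,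
      pressureForm_symm z c a, ← mul_assoc, mul_inv_cancel₀ hl0.ne', one_mul]
  rw [hscale (x - y), hscale (x₀ - y)]
  refine (hquad _ _).trans (le_of_eq ?_)
  rw [norm_smul, norm_smul, Real.norm_eq_abs, Real.norm_eq_abs, abs_of_pos hl0,
    abs_of_pos (inv_pos.2 hl0), mul_pow, mul_pow, inv_pow, hl2, hM]
  field_simp
  ring

end TwoCentre

/-! ## §3. The far field of uniformly locally `L²` slices; the difference of two far fields -/

section FarField

variable {U U₁ U₂ : EuclideanSpace ℝ (Fin 3) → EuclideanSpace ℝ (Fin 3)} {A : ℝ≥0∞}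
  {x₀ x : EuclideanSpace ℝ (Fin 3)} {r : ℝ}

/-- Off `B_{2r}(x₀)` and for `x ∈ B_r(x₀)`: `2|x-x₀| ≤ |y-x₀|` and `y ≠ x₀`. [folklore] -/
theorem two_mul_norm_sub_le_of_mem (hr : 0 < r) (hx : x ∈ ball x₀ r) {y : EuclideanSpace ℝ (Fin 3)}
    (hy : y ∈ (ball x₀ (2 * r))ᶜ) : 2 * ‖x - x₀‖ ≤ ‖y - x₀‖ ∧ y ≠ x₀ := by
  rw [mem_compl_iff, mem_ball, dist_eq_norm, not_lt] at hy
  rw [mem_ball, dist_eq_norm] at hx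
  refine ⟨by linarith, fun h => ?_⟩
  rw [h, sub_self, norm_zero] at hy
  linarith

/-- The weight `|y-x₀|⁻⁴` in `ℝ≥0∞`: `‖(‖y-x₀‖⁴)⁻¹‖ₑ = ofReal (‖y-x₀‖⁴)⁻¹`. [folklore] -/
theorem enorm_inv_norm_pow_four (y x₀ : EuclideanSpace ℝ (Fin 3)) :
    ‖(‖y - x₀‖ ^ 4)⁻¹‖ₑ = ENNReal.ofReal ((‖y - x₀‖ ^ 4)⁻¹) :=
  Real.enorm_eq_ofReal (by positivity)

/-- **Tails of a uniformly locally `L²` slice are finite:** for measurable `U` with unit-ball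
energies `≤ A < ∞`, `r ≥ 1` and any centre, `∫_{|y-x₀| ≥ 2r} |U|² |y-x₀|⁻⁴ < ∞`
(`exists_farField_tail_le` with unit balls). [folklore] -/
theorem lintegral_compl_ball_sq_mul_lt_top (hU : AEStronglyMeasurable U volume) (hAt : A ≠ ⊤)
    (hA : ∀ z : EuclideanSpace ℝ (Fin 3), ∫⁻ y in ball z 1, ‖U y‖ₑ ^ 2 ≤ A) (hr : 1 ≤ r)
    (x₀ : EuclideanSpace ℝ (Fin 3)) :
    ∫⁻ y in (ball x₀ (2 * r))ᶜ, ‖U y‖ₑ ^ 2 * ENNReal.ofReal ((‖y - x₀‖ ^ 4)⁻¹) < ⊤ := by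
  obtain ⟨K, hKt, hK⟩ := exists_farField_tail_le (r := 1) one_pos
  have h := hK (fun y => ‖U y‖ₑ ^ 2) (hU.enorm.pow_const 2) A hA x₀ (2 * r) (by linarith)
  refine lt_of_le_of_lt h ?_
  exact ENNReal.mul_lt_top (ENNReal.mul_lt_top hKt.lt_top ENNReal.ofReal_lt_top) hAt.lt_top

/-- **Absolute convergence of the far-field integrand** `y ↦ K(x-y)(U y) - K(x₀-y)(U y)` on
`{|y-x₀| ≥ 2r}` for `x ∈ B_r(x₀)`, `r ≥ 1`, and a measurable slice `U` with unit-ball energies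
`≤ A < ∞` (the two-centre bound `≤ C r|U|²|y-x₀|⁻⁴` and the finiteness of the tail).
[cite: KangMiuraTsai2020, §8 proof of Lemma 3.4 (pointwise bound for p_far), arXiv:1812.10509 p. 18] -/
theorem integrableOn_farField_of_uloc (hU : AEStronglyMeasurable U volume) (hAt : A ≠ ⊤)
    (hA : ∀ z : EuclideanSpace ℝ (Fin 3), ∫⁻ y in ball z 1, ‖U y‖ₑ ^ 2 ≤ A) (hr : 1 ≤ r)
    (hx : x ∈ ball x₀ r) :
    IntegrableOn (fun y => pressureKernel (x - y) (U y) - pressureKernel (x₀ - y) (U y))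
      (ball x₀ (2 * r))ᶜ volume := by
  obtain ⟨C, hC0, hC⟩ := exists_abs_pressureKernel_sub_le
  have hr0 : 0 < r := lt_of_lt_of_le one_pos hr
  -- measurability
  have hm : AEStronglyMeasurable (fun y => pressureKernel (x - y) (U y) - pressureKernel (x₀ - y) (U y))
      (volume.restrict (ball x₀ (2 * r))ᶜ) :=
    ((aestronglyMeasurable_pressureKernel_sub_apply hU x).sub
      (aestronglyMeasurable_pressureKernel_sub_apply hU x₀)).restrict
  -- the dominating function `C r |U|² |y-x₀|⁻⁴`
  set g : EuclideanSpace ℝ (Fin 3) → ℝ := fun y => C * r * (‖U y‖ ^ 2 * (‖y - x₀‖ ^ 4)⁻¹) with hg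
  have hgm : AEStronglyMeasurable g (volume.restrict (ball x₀ (2 * r))ᶜ) := by
    have h1 : AEStronglyMeasurable (fun y => ‖U y‖ ^ 2) volume :=
      (continuous_norm.pow 2).comp_aestronglyMeasurable hU
    have h2 : AEStronglyMeasurable (fun y : EuclideanSpace ℝ (Fin 3) => (‖y - x₀‖ ^ 4)⁻¹) volume :=
      (((continuous_norm.comp (continuous_id.sub continuous_const)).pow 4).measurable.inv).aestronglyMeasurable
    exact ((h1.mul h2).const_mul (C * r)).restrict
  have hgi : Integrable g (volume.restrict (ball x₀ (2 * r))ᶜ) := by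
    refine ⟨hgm, ?_⟩
    rw [HasFiniteIntegral]
    have e : ∀ y, ‖g y‖ₑ = ENNReal.ofReal (C * r) * (‖U y‖ₑ ^ 2 * ENNReal.ofReal ((‖y - x₀‖ ^ 4)⁻¹)) := by
      intro y
      rw [hg]
      dsimp only
      have hCr : 0 ≤ C * r := by positivity
      rw [Real.enorm_eq_ofReal (by positivity), ENNReal.ofReal_mul hCr,
        ENNReal.ofReal_mul (sq_nonneg _), ENNReal.ofReal_pow (norm_nonneg _), ofReal_norm]
    simp_rw [e]
    have hmeas : AEMeasurable (fun y => ‖U y‖ₑ ^ 2 * ENNReal.ofReal ((‖y - x₀‖ ^ 4)⁻¹))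
        (volume.restrict (ball x₀ (2 * r))ᶜ) :=
      ((hU.enorm.pow_const 2).mul (measurable_ofReal_inv_norm_pow_four x₀).aemeasurable).restrict
    rw [lintegral_const_mul'' _ hmeas]
    exact ENNReal.mul_lt_top ENNReal.ofReal_lt_top (lintegral_compl_ball_sq_mul_lt_top hU hAt hA hr x₀)
  refine hgi.mono' hm ?_
  refine (ae_restrict_iff' measurableSet_ball.compl).2 (Eventually.of_forall fun y hy => ?_)
  obtain ⟨h2, hy0⟩ := two_mul_norm_sub_le_of_mem hr0 hx hy
  have hxx₀ : ‖x - x₀‖ < r := by rwa [mem_ball, dist_eq_norm] at hx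
  rw [Real.norm_eq_abs]
  calc |pressureKernel (x - y) (U y) - pressureKernel (x₀ - y) (U y)|
      ≤ C * ‖x - x₀‖ * ‖U y‖ ^ 2 / ‖y - x₀‖ ^ 4 := hC x₀ x y (U y) h2 hy0
    _ = C * ‖x - x₀‖ * (‖U y‖ ^ 2 * (‖y - x₀‖ ^ 4)⁻¹) := by ring
    _ ≤ C * r * (‖U y‖ ^ 2 * (‖y - x₀‖ ^ 4)⁻¹) := by gcongr

/-- **The far field does not depend on the time parametrisation**: `localPressureFar x₀ r u t`
is the far field of the slice `u t`. [folklore] -/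
theorem localPressureFar_eq_integral (x₀ : EuclideanSpace ℝ (Fin 3)) (r : ℝ)
    (u : ℝ → EuclideanSpace ℝ (Fin 3) → EuclideanSpace ℝ (Fin 3)) (t : ℝ) (x : EuclideanSpace ℝ (Fin 3)) :
    localPressureFar x₀ r u t x = ∫ y in (ball x₀ (2 * r))ᶜ,
      (pressureKernel (x - y) (u t y) - pressureKernel (x₀ - y) (u t y)) :=
  localPressureFar_apply x₀ r u t x

/-- **The difference of the far fields of two fields is the far field of `B(U₁ - U₂, U₁ + U₂)`,
pointwise bound** (Lemarié-Rieusset 2016, p. 516: the terms `S₁ + S₂` built on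
`ℍ = u₁ ⊗ u₁ - u₂ ⊗ u₂`; Kang–Miura–Tsai 2021, §8 for the kernel bound): for two measurable
slices with unit-ball energies `≤ A < ∞`, `r ≥ 1` and `x ∈ B_r(x₀)`,
`‖π_far[U₁](x) - π_far[U₂](x)‖ ≤ C r ∫_{|y-x₀|≥2r} |U₁ - U₂| |U₁ + U₂| |y-x₀|⁻⁴ dy`, with `C` the
two-centre constant of the quadratic kernel.
[cite: LemarieRieusset2016, Thm. 14.7, proof (file p. 516), the terms S₁, S₂] -/
theorem enorm_localPressureFar_sub_le {C : ℝ} (hC0 : 0 ≤ C)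
    (hC : ∀ x₀ x y a : EuclideanSpace ℝ (Fin 3), 2 * ‖x - x₀‖ ≤ ‖y - x₀‖ → y ≠ x₀ →
      |pressureKernel (x - y) a - pressureKernel (x₀ - y) a| ≤
        C * ‖x - x₀‖ * ‖a‖ ^ 2 / ‖y - x₀‖ ^ 4)
    {u₁ u₂ : ℝ → EuclideanSpace ℝ (Fin 3) → EuclideanSpace ℝ (Fin 3)} {t : ℝ}
    (hU₁ : AEStronglyMeasurable (u₁ t) volume) (hU₂ : AEStronglyMeasurable (u₂ t) volume) (hAt : A ≠ ⊤)
    (hA₁ : ∀ z : EuclideanSpace ℝ (Fin 3), ∫⁻ y in ball z 1, ‖u₁ t y‖ₑ ^ 2 ≤ A)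
    (hA₂ : ∀ z : EuclideanSpace ℝ (Fin 3), ∫⁻ y in ball z 1, ‖u₂ t y‖ₑ ^ 2 ≤ A)
    (hr : 1 ≤ r) (hx : x ∈ ball x₀ r) :
    ‖localPressureFar x₀ r u₁ t x - localPressureFar x₀ r u₂ t x‖ₑ ≤
      ENNReal.ofReal (C * r) * ∫⁻ y in (ball x₀ (2 * r))ᶜ,
        ‖u₁ t y - u₂ t y‖ₑ * ‖u₁ t y + u₂ t y‖ₑ * ENNReal.ofReal ((‖y - x₀‖ ^ 4)⁻¹) := by
  have hr0 : 0 < r := lt_of_lt_of_le one_pos hr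
  have hxx₀ : ‖x - x₀‖ < r := by rwa [mem_ball, dist_eq_norm] at hx
  have hI₁ := integrableOn_farField_of_uloc hU₁ hAt hA₁ hr hx
  have hI₂ := integrableOn_farField_of_uloc hU₂ hAt hA₂ hr hx
  rw [localPressureFar_eq_integral, localPressureFar_eq_integral, ← integral_sub hI₁ hI₂]
  have hpt : ∀ y, pressureKernel (x - y) (u₁ t y) - pressureKernel (x₀ - y) (u₁ t y) -
      (pressureKernel (x - y) (u₂ t y) - pressureKernel (x₀ - y) (u₂ t y)) =
      pressureForm (x - y) (u₁ t y - u₂ t y) (u₁ t y + u₂ t y) -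
        pressureForm (x₀ - y) (u₁ t y - u₂ t y) (u₁ t y + u₂ t y) := by
    intro y
    rw [← pressureKernel_sub_eq_pressureForm', ← pressureKernel_sub_eq_pressureForm']
    ring
  simp_rw [hpt]
  refine (enorm_integral_le_lintegral_enorm _).trans ?_
  rw [← lintegral_const_mul' _ _ ENNReal.ofReal_ne_top]
  refine setLIntegral_mono' measurableSet_ball.compl fun y hy => ?_
  obtain ⟨h2, hy0⟩ := two_mul_norm_sub_le_of_mem hr0 hx hy
  have hb := abs_pressureForm_sub_pressureForm_le hC0 hC h2 hy0 (u₁ t y - u₂ t y) (u₁ t y + u₂ t y)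
  rw [Real.enorm_eq_ofReal_abs, ← ofReal_norm, ← ofReal_norm,
    ← ENNReal.ofReal_mul (by positivity), ← ENNReal.ofReal_mul (by positivity),
    ← ENNReal.ofReal_mul (by positivity)]
  refine ENNReal.ofReal_le_ofReal (hb.trans ?_)
  calc C * ‖x - x₀‖ * (‖u₁ t y - u₂ t y‖ * ‖u₁ t y + u₂ t y‖) / ‖y - x₀‖ ^ 4
      = C * ‖x - x₀‖ * (‖u₁ t y - u₂ t y‖ * ‖u₁ t y + u₂ t y‖ * (‖y - x₀‖ ^ 4)⁻¹) := by ring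
    _ ≤ C * r * (‖u₁ t y - u₂ t y‖ * ‖u₁ t y + u₂ t y‖ * (‖y - x₀‖ ^ 4)⁻¹) := by gcongr

end FarField

/-! ## §4. Unit-ball Hölder inequalities for the uniformly local tails -/

section UnitBall

variable {W V : EuclideanSpace ℝ (Fin 3) → EuclideanSpace ℝ (Fin 3)}

/-- **Cauchy–Schwarz on a ball:** `∫_{B(z,ρ)} |W| ≤ |B(z,ρ)|^{1/2} (∫_{B(z,ρ)} |W|²)^{1/2}`.
[folklore] -/
theorem lintegral_ball_enorm_le_sqrt (hW : AEStronglyMeasurable W volume) (z : EuclideanSpace ℝ (Fin 3)) (ρ : ℝ) :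
    ∫⁻ y in ball z ρ, ‖W y‖ₑ ≤
      (volume (ball z ρ)) ^ (1 / 2 : ℝ) * (∫⁻ y in ball z ρ, ‖W y‖ₑ ^ 2) ^ (1 / 2 : ℝ) := by
  set μ : Measure (EuclideanSpace ℝ (Fin 3)) := volume.restrict (ball z ρ) with hμ
  have hpq : (2 : ℝ).HolderConjugate 2 := by
    have := Real.holderConjugate_one_div (a := 1 / 2) (b := 1 / 2) (by norm_num) (by norm_num) (by norm_num)
    norm_num at this
    exact this
  have h := ENNReal.lintegral_mul_le_Lp_mul_Lq μ hpq (f := fun _ => (1 : ℝ≥0∞)) (g := fun y => ‖W y‖ₑ)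
    aemeasurable_const hW.restrict.enorm
  have h' : ∫⁻ y, ‖W y‖ₑ ∂μ ≤ (∫⁻ _y, (1 : ℝ≥0∞) ^ (2 : ℝ) ∂μ) ^ (1 / (2 : ℝ)) *
      (∫⁻ y, ‖W y‖ₑ ^ (2 : ℝ) ∂μ) ^ (1 / (2 : ℝ)) := by
    simpa only [Pi.mul_apply, one_mul] using h
  have e1 : ∫⁻ _y, (1 : ℝ≥0∞) ^ (2 : ℝ) ∂μ = volume (ball z ρ) := by
    rw [ENNReal.one_rpow, lintegral_const, one_mul, hμ, Measure.restrict_apply_univ]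
  have e2 : ∫⁻ y, ‖W y‖ₑ ^ (2 : ℝ) ∂μ = ∫⁻ y, ‖W y‖ₑ ^ 2 ∂μ :=
    lintegral_congr fun y => by rw [show (2 : ℝ) = ((2 : ℕ) : ℝ) by norm_num, ENNReal.rpow_natCast]
  rw [e1, e2] at h'
  exact h'

/-- **Hölder on a ball with the exponents `3/2`, `3`, then `4`, `4/3`:**
`∫_{B(z,ρ)} |W||V| ≤ |B(z,ρ)|^{1/6} (∫_{B(z,ρ)} |W|²)^{1/2} ‖V‖_{L³(ℝ³)}`. [folklore] -/
theorem lintegral_ball_enorm_mul_enorm_le (hW : AEStronglyMeasurable W volume) (hV : AEStronglyMeasurable V volume)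
    (z : EuclideanSpace ℝ (Fin 3)) (ρ : ℝ) :
    ∫⁻ y in ball z ρ, ‖W y‖ₑ * ‖V y‖ₑ ≤
      (volume (ball z ρ)) ^ (1 / 6 : ℝ) * (∫⁻ y in ball z ρ, ‖W y‖ₑ ^ 2) ^ (1 / 2 : ℝ) *
        eLpNorm V 3 volume := by
  set μ : Measure (EuclideanSpace ℝ (Fin 3)) := volume.restrict (ball z ρ) with hμ
  -- `∫ |W||V| ≤ ‖W‖_{L^{3/2}(μ)} ‖V‖_{L³(μ)}`
  have hpq : (3 / 2 : ℝ).HolderConjugate 3 := by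
    have := Real.holderConjugate_one_div (a := 2 / 3) (b := 1 / 3) (by norm_num) (by norm_num) (by norm_num)
    norm_num at this
    exact this
  have h1 := ENNReal.lintegral_mul_le_Lp_mul_Lq μ hpq (f := fun y => ‖W y‖ₑ) (g := fun y => ‖V y‖ₑ)
    hW.restrict.enorm hV.restrict.enorm
  -- `‖W‖_{L^{3/2}(μ)} ≤ |B|^{1/6} ‖W‖_{L²(μ)}`: Hölder `4, 4/3` on `1 · |W|^{3/2}`
  have hpq' : (4 : ℝ).HolderConjugate (4 / 3) := by
    have := Real.holderConjugate_one_div (a := 1 / 4) (b := 3 / 4) (by norm_num) (by norm_num) (by norm_num)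
    norm_num at this
    exact this
  have h2 := ENNReal.lintegral_mul_le_Lp_mul_Lq μ hpq' (f := fun _ => (1 : ℝ≥0∞))
    (g := fun y => ‖W y‖ₑ ^ (3 / 2 : ℝ)) aemeasurable_const (hW.restrict.enorm.pow_const (3 / 2 : ℝ))
  have h2' : ∫⁻ y, ‖W y‖ₑ ^ (3 / 2 : ℝ) ∂μ ≤ (∫⁻ _y, (1 : ℝ≥0∞) ^ (4 : ℝ) ∂μ) ^ (1 / (4 : ℝ)) *
      (∫⁻ y, (‖W y‖ₑ ^ (3 / 2 : ℝ)) ^ (4 / 3 : ℝ) ∂μ) ^ (1 / (4 / 3 : ℝ)) := by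
    simpa only [Pi.mul_apply, one_mul] using h2
  have e1 : ∫⁻ _y, (1 : ℝ≥0∞) ^ (4 : ℝ) ∂μ = volume (ball z ρ) := by
    rw [ENNReal.one_rpow, lintegral_const, one_mul, hμ, Measure.restrict_apply_univ]
  have e43 : ∫⁻ y, (‖W y‖ₑ ^ (3 / 2 : ℝ)) ^ (4 / 3 : ℝ) ∂μ = ∫⁻ y, ‖W y‖ₑ ^ 2 ∂μ :=
    lintegral_congr fun y => by
      rw [← ENNReal.rpow_mul, show (3 / 2 : ℝ) * (4 / 3) = ((2 : ℕ) : ℝ) by norm_num, ENNReal.rpow_natCast]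
  rw [e1, e43, show (1 : ℝ) / (4 / 3) = 3 / 4 by norm_num] at h2'
  have h3 : (∫⁻ y, ‖W y‖ₑ ^ (3 / 2 : ℝ) ∂μ) ^ (1 / (3 / 2 : ℝ)) ≤
      (volume (ball z ρ)) ^ (1 / 6 : ℝ) * (∫⁻ y, ‖W y‖ₑ ^ 2 ∂μ) ^ (1 / 2 : ℝ) := by
    rw [show (1 : ℝ) / (3 / 2) = 2 / 3 by norm_num]
    calc (∫⁻ y, ‖W y‖ₑ ^ (3 / 2 : ℝ) ∂μ) ^ (2 / 3 : ℝ)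
        ≤ ((volume (ball z ρ)) ^ (1 / (4 : ℝ)) * (∫⁻ y, ‖W y‖ₑ ^ 2 ∂μ) ^ (3 / 4 : ℝ)) ^ (2 / 3 : ℝ) :=
          ENNReal.rpow_le_rpow h2' (by norm_num)
      _ = (volume (ball z ρ)) ^ (1 / 6 : ℝ) * (∫⁻ y, ‖W y‖ₑ ^ 2 ∂μ) ^ (1 / 2 : ℝ) := by
          rw [ENNReal.mul_rpow_of_nonneg _ _ (by norm_num), ← ENNReal.rpow_mul, ← ENNReal.rpow_mul]
          norm_num
  -- `‖V‖_{L³(μ)} ≤ ‖V‖_{L³}`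
  have h4 : (∫⁻ y, ‖V y‖ₑ ^ (3 : ℝ) ∂μ) ^ (1 / (3 : ℝ)) ≤ eLpNorm V 3 volume := by
    have e : eLpNorm V 3 μ = (∫⁻ y, ‖V y‖ₑ ^ (3 : ℝ) ∂μ) ^ (1 / (3 : ℝ)) := by
      rw [eLpNorm_eq_lintegral_rpow_enorm_toReal (by norm_num) ENNReal.ofNat_ne_top, ENNReal.toReal_ofNat]
    rw [← e]
    exact eLpNorm_mono_measure V Measure.restrict_le_self
  calc ∫⁻ y, ‖W y‖ₑ * ‖V y‖ₑ ∂μ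
      ≤ (∫⁻ y, ‖W y‖ₑ ^ (3 / 2 : ℝ) ∂μ) ^ (1 / (3 / 2 : ℝ)) * (∫⁻ y, ‖V y‖ₑ ^ (3 : ℝ) ∂μ) ^ (1 / (3 : ℝ)) := by
        simpa only [Pi.mul_apply] using h1
    _ ≤ (volume (ball z ρ)) ^ (1 / 6 : ℝ) * (∫⁻ y, ‖W y‖ₑ ^ 2 ∂μ) ^ (1 / 2 : ℝ) * eLpNorm V 3 volume :=
        mul_le_mul' h3 h4

end UnitBall

end Literature.Analysis.FluidPDE
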